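import Literature.Geometry.Lorentzian.CoordTensorCovariance
import Literature.Geometry.Lorentzian.CoordRicciScaling
import Summits.FinalStateConjecture.FinalStateConjecture.Theorems.BartnikGapSettlingGapExhaustionMetricInCoordsCompAffine
import HarnessLib

/-!
# Affine and constant-rescaling covariance of the coordinate Killing expression, of the
# coordinate Hessian and of metric data
(crux `GapExhaustion`, stmt-FinalStateConjecture-10808, line photon-shell-pseudoconvexity;
stub (N-3ab) `stub_affineCovariance` of the reduction of the outward Killing-extension sweep S5
to the Ionescu–Klainerman local extension theorem in chart form)

The chart form of the local extension theorem is typed over metric components `G` on the unit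
ball with `G p = η`. To apply it at a point of a near-Kerr chart one passes to the affine chart
`y ↦ c + L y` (`L : E4 ≃L[ℝ] E4` the scaled normalising frame) and rescales `G` by a constant.
This file is the covariance bookkeeping of that change of chart, in the tree's `MetricCoord`
calculus:

1. `affineCov_killingExpr` — the coordinate Killing expression
   `DG(k)(Y,Z) + G(Dk Y, Z) + G(Y, Dk Z)` of the transformed pair
   `G' y := G(c + L y) ∘ (L × L)`, `k' y := L⁻¹ k(c + L y)` at `(y, Y, Z)` equals that of `(G, k)`
   at `(c + L y, L Y, L Z)` (chain rule: `y ↦ B (G (c + L y))` with `B = (· ∘ (L × L))` linear,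
   `compAffine_exists_bilinearCompCLM`, and `y ↦ L⁻¹ (k (c + L y))`);
2. `affineCov_hessAt` — the coordinate Hessian is tensorial under the affine change:
   `Hess_{G'} (f ∘ aff) (y) (Y, Z) = Hess_G f (aff y) (L Y, L Z)`: `G' = pullMetric G aff`
   (`Daff = L` everywhere), so by the transformation law of the Christoffel map
   (`IsMetricOn.chrAt_pullMetric`, O'Neill 1983, Ch. 3, Prop. 3.59) and `D²aff = 0`,
   `L Γ'(Y,Z) = Γ(L Y, L Z)`, while `D(f ∘ aff) = Df ∘ L` near `y` and
   `D²(f ∘ aff)(y)(Y,Z) = D²f(aff y)(L Y, L Z)`;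
3. `affineCov_constSmul` — for a constant `s ≠ 0`, `s • G` is again a metric datum on `V`
   (`isMetricOn_conformal`) with the same Christoffel map (Besse 1987, Thm. 1.159 (a) with the
   constant conformal factor: the conformal one-form vanishes, `confForm_const_apply`), hence the
   same coordinate Hessian.

## References
* [ONeill1983] B. O'Neill, *Semi-Riemannian Geometry*, Academic Press 1983, Ch. 3, Prop. 3.59,
  Lemma 3.49.
* [Besse1987] A. L. Besse, *Einstein manifolds*, Springer 1987, Thm. 1.159 (a).
-/

noncomputable section

-- instance search through the nested operator types `E4 →L[ℝ] E4 →L[ℝ] ℝ`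
set_option maxSynthPendingDepth 3

-- D-0017: single-problem summit, `Summit.<S>.<S>.…` by design (cf. lakefile `weak.linter.dupNamespace`).
set_option linter.dupNamespace false

namespace Summit.FinalStateConjecture.FinalStateConjecture.Theorems

open Set Function Filter
open Literature.Geometry.Lorentzian Literature.Geometry.Lorentzian.MetricCoord
open scoped ContDiff Topology

/-! ### The affine change of chart `aff(y) = c + L y` -/

/-- The affine map `y ↦ c + L y` has derivative `L` at every point. [folklore] -/
theorem affineCov_hasFDerivAt (L : E4 ≃L[ℝ] E4) (c y : E4) :
    HasFDerivAt (fun y : E4 => c + L y) (L : E4 →L[ℝ] E4) y :=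
  L.hasFDerivAt.const_add c

/-- The Jacobian of `y ↦ c + L y` is the constant `L`. [folklore] -/
theorem affineCov_fderiv (L : E4 ≃L[ℝ] E4) (c y : E4) :
    fderiv ℝ (fun y : E4 => c + L y) y = (L : E4 →L[ℝ] E4) :=
  (affineCov_hasFDerivAt L c y).fderiv

/-- The second derivative of the affine map `y ↦ c + L y` vanishes. [folklore] -/
theorem affineCov_fderiv_fderiv (L : E4 ≃L[ℝ] E4) (c y : E4) :
    fderiv ℝ (fderiv ℝ (fun y : E4 => c + L y)) y = 0 := by
  have h : fderiv ℝ (fun y : E4 => c + L y) = fun _ : E4 => (L : E4 →L[ℝ] E4) :=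
    funext (affineCov_fderiv L c)
  rw [h, fderiv_fun_const, Pi.zero_apply]

/-- For metric components `G` on an open `V`, the affine map `y ↦ c + L y` (`L` invertible) is a
change of coordinates from `aff⁻¹(V)` onto `V` in the sense of `MetricCoord.IsCoordChangeOn`.
[folklore] -/
theorem affineCov_isCoordChangeOn {G : E4 → E4 →L[ℝ] E4 →L[ℝ] ℝ} {V : Set E4}
    (hG : IsMetricOn G V) (L : E4 ≃L[ℝ] E4) (c : E4) :
    IsCoordChangeOn (fun y : E4 => c + L y) ((fun y : E4 => c + L y) ⁻¹' V) V where
  isOpen := hG.isOpen.preimage (continuous_const.add L.continuous)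
  contDiffOn := (contDiff_const.add (L : E4 →L[ℝ] E4).contDiff).contDiffOn
  mapsTo := mapsTo_preimage _ V
  isInvertible y _ := by
    rw [affineCov_fderiv]
    exact ⟨L, rfl⟩

/-- The transformed components `y ↦ G(c + L y) ∘ (L × L)` ARE the pulled-back components
`pullMetric G aff` of the tree (`Daff = L` at every point). [folklore] -/
theorem affineCov_eq_pullMetric (G : E4 → E4 →L[ℝ] E4 →L[ℝ] ℝ) (L : E4 ≃L[ℝ] E4) (c : E4) :
    (fun y : E4 => (G (c + L y)).bilinearComp (L : E4 →L[ℝ] E4) (L : E4 →L[ℝ] E4)) =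
      pullMetric G (fun y : E4 => c + L y) := by
  funext y
  rw [pullMetric, affineCov_fderiv]

/-! ### (1) The coordinate Killing expression -/

/-- **Affine covariance of the coordinate Killing expression.** For `G` and `k` differentiable
at `x = c + L y`, the expression `DG'(k')(Y,Z) + G'(Dk' Y, Z) + G'(Y, Dk' Z)` of the transformed
pair `G' y = G(c + L y) ∘ (L × L)`, `k' y = L⁻¹ k(c + L y)` at `(y, Y, Z)` equals
`DG(k)(LY, LZ) + G(Dk (LY), LZ) + G(LY, Dk (LZ))` at `x` (pure chain rule: `G' = B ∘ G ∘ aff`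
with `B = (· ∘ (L × L))` continuous linear, `k' = L⁻¹ ∘ k ∘ aff`, `Daff = L`). [folklore] -/
theorem affineCov_killingExpr (G : E4 → E4 →L[ℝ] E4 →L[ℝ] ℝ) (k : E4 → E4) (L : E4 ≃L[ℝ] E4)
    (c y Y Z : E4) (hG : DifferentiableAt ℝ G (c + L y)) (hk : DifferentiableAt ℝ k (c + L y)) :
    fderiv ℝ (fun y : E4 => (G (c + L y)).bilinearComp (L : E4 →L[ℝ] E4) (L : E4 →L[ℝ] E4)) y
          ((L.symm : E4 →L[ℝ] E4) (k (c + L y))) Y Z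
        + (G (c + L y)).bilinearComp (L : E4 →L[ℝ] E4) (L : E4 →L[ℝ] E4)
            (fderiv ℝ (fun y : E4 => (L.symm : E4 →L[ℝ] E4) (k (c + L y))) y Y) Z
        + (G (c + L y)).bilinearComp (L : E4 →L[ℝ] E4) (L : E4 →L[ℝ] E4) Y
            (fderiv ℝ (fun y : E4 => (L.symm : E4 →L[ℝ] E4) (k (c + L y))) y Z)
      = fderiv ℝ G (c + L y) (k (c + L y)) (L Y) (L Z)
          + G (c + L y) (fderiv ℝ k (c + L y) (L Y)) (L Z)
          + G (c + L y) (L Y) (fderiv ℝ k (c + L y) (L Z)) := by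
  obtain ⟨B, -, hB⟩ := compAffine_exists_bilinearCompCLM (L : E4 →L[ℝ] E4)
  have haff := affineCov_hasFDerivAt L c y
  -- the transformed components are `B ∘ G ∘ aff`, the transformed field is `L⁻¹ ∘ k ∘ aff`
  have hfun : (fun y : E4 => (G (c + L y)).bilinearComp (L : E4 →L[ℝ] E4) (L : E4 →L[ℝ] E4)) =
      fun y : E4 => B (G (c + L y)) :=
    funext fun y => (hB _).symm
  have hG' : HasFDerivAt (fun y : E4 => B (G (c + L y)))
      (B.comp ((fderiv ℝ G (c + L y)).comp (L : E4 →L[ℝ] E4))) y :=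
    B.hasFDerivAt.comp y (hG.hasFDerivAt.comp y haff)
  have hk' : HasFDerivAt (fun y : E4 => (L.symm : E4 →L[ℝ] E4) (k (c + L y)))
      ((L.symm : E4 →L[ℝ] E4).comp ((fderiv ℝ k (c + L y)).comp (L : E4 →L[ℝ] E4))) y :=
    (L.symm : E4 →L[ℝ] E4).hasFDerivAt.comp y (hk.hasFDerivAt.comp y haff)
  rw [hfun, hG'.fderiv, hk'.fderiv]
  simp only [ContinuousLinearMap.comp_apply, hB, ContinuousLinearMap.bilinearComp_apply,
    ContinuousLinearEquiv.coe_coe, ContinuousLinearEquiv.apply_symm_apply]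

/-! ### (2) The coordinate Hessian -/

/-- **The coordinate Hessian is tensorial under an affine change of chart**: for metric
components `G` on an open `V ∋ c + L y` and `f` of class `C²` at `c + L y`,
`Hess_{G'} (f ∘ aff) (y) (Y, Z) = Hess_G f (c + L y) (L Y, L Z)` with
`G' y = G(c + L y) ∘ (L × L) = pullMetric G aff`, `aff y = c + L y` (transformation law of the
Christoffel map, O'Neill 1983, Ch. 3, Prop. 3.59, with `D²aff = 0`; `Hess f` is the covariant
tensor `∇df`, Lemma 3.49). [cite: ONeill1983, Ch. 3, Prop. 3.59] -/
theorem affineCov_hessAt (G : E4 → E4 →L[ℝ] E4 →L[ℝ] ℝ) (f : E4 → ℝ) (L : E4 ≃L[ℝ] E4)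
    (c y : E4) (V : Set E4) (hG : IsMetricOn G V) (hy : c + L y ∈ V)
    (hf : ContDiffAt ℝ 2 f (c + L y)) (Y Z : E4) :
    hessAt (fun y : E4 => (G (c + L y)).bilinearComp (L : E4 →L[ℝ] E4) (L : E4 →L[ℝ] E4))
        (fun y : E4 => f (c + L y)) y Y Z
      = hessAt G f (c + L y) (L Y) (L Z) := by
  have haff := affineCov_hasFDerivAt L c
  have hcc := affineCov_isCoordChangeOn hG L c
  have hyV' : y ∈ (fun y : E4 => c + L y) ⁻¹' V := hy
  -- the Christoffel maps: `L Γ'(Y,Z) = Γ(LY, LZ)`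
  have hchr : (L : E4 →L[ℝ] E4) (chrAt (pullMetric G (fun y : E4 => c + L y)) y Y Z) =
      chrAt G (c + L y) (L Y) (L Z) := by
    have h := hG.chrAt_pullMetric hcc hyV' Y Z
    rw [affineCov_fderiv, affineCov_fderiv_fderiv] at h
    simpa using h
  -- the first derivative of `f ∘ aff` near `y`
  have hf1 : ∀ᶠ y' in 𝓝 y, HasFDerivAt (fun y : E4 => f (c + L y))
      ((fderiv ℝ f (c + L y')).comp (L : E4 →L[ℝ] E4)) y' := by
    have hev : ∀ᶠ x' in 𝓝 (c + L y), DifferentiableAt ℝ f x' := by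
      filter_upwards [hf.eventually (by simp)] with x' hx' using hx'.differentiableAt (by simp)
    filter_upwards [(haff y).continuousAt.preimage_mem_nhds hev] with y' hy'
    exact hy'.hasFDerivAt.comp y' (haff y')
  have hDf' : fderiv ℝ (fun y : E4 => f (c + L y)) =ᶠ[𝓝 y]
      fun y' : E4 => (fderiv ℝ f (c + L y')).comp (L : E4 →L[ℝ] E4) :=
    hf1.mono fun y' h => h.fderiv
  have hDf'y : fderiv ℝ (fun y : E4 => f (c + L y)) y =
      (fderiv ℝ f (c + L y)).comp (L : E4 →L[ℝ] E4) :=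
    hDf'.self_of_nhds
  -- the second derivative of `f ∘ aff` at `y`
  have hD2 : fderiv ℝ (fderiv ℝ (fun y : E4 => f (c + L y))) y Y Z =
      fderiv ℝ (fderiv ℝ f) (c + L y) (L Y) (L Z) := by
    rw [hDf'.fderiv_eq]
    have hdf : DifferentiableAt ℝ (fderiv ℝ f) (c + L y) :=
      (hf.fderiv_right (m := 1) le_rfl).differentiableAt one_ne_zero
    have hP₀ := (ContinuousLinearMap.precomp ℝ (L : E4 →L[ℝ] E4)).hasFDerivAt.comp y
      (hdf.hasFDerivAt.comp y (haff y))
    have hP : HasFDerivAt (fun y' : E4 => (fderiv ℝ f (c + L y')).comp (L : E4 →L[ℝ] E4))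
        ((ContinuousLinearMap.precomp ℝ (L : E4 →L[ℝ] E4)).comp
          ((fderiv ℝ (fderiv ℝ f) (c + L y)).comp (L : E4 →L[ℝ] E4))) y := hP₀
    rw [hP.fderiv]
    simp only [ContinuousLinearMap.comp_apply, ContinuousLinearMap.precomp_apply,
      ContinuousLinearEquiv.coe_coe]
  rw [affineCov_eq_pullMetric, hessAt_apply, hessAt_apply, hD2, hDf'y,
    ContinuousLinearMap.comp_apply, hchr]

/-! ### (3) Constant rescaling -/

/-- **Constant rescaling of metric data.** For a constant `s ≠ 0` and metric components `G` on
`V`, `s • G` is again a metric datum on `V`, with the same Christoffel map at every point of `V`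
(Besse 1987, Thm. 1.159 (a) with a constant conformal factor: the conformal one-form
`θ = ds/(2s)` vanishes, so the difference tensor is zero — the factor cancels between `(sG)⁻¹`
and `D(sG)`), hence the same coordinate Hessian `D²f − Df ∘ Γ`.
[cite: Besse1987, Thm. 1.159 (a)] -/
theorem affineCov_constSmul (G : E4 → E4 →L[ℝ] E4 →L[ℝ] ℝ) (V : Set E4) (s : ℝ) (hs : s ≠ 0)
    (hG : IsMetricOn G V) :
    IsMetricOn (fun y : E4 => s • G y) V ∧
      ∀ x ∈ V, chrAt (fun y : E4 => s • G y) x = chrAt G x ∧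
        ∀ f : E4 → ℝ, hessAt (fun y : E4 => s • G y) f x = hessAt G f x := by
  have hc : ContDiffOn ℝ ∞ (fun _ : E4 => s) V := contDiffOn_const
  have hc0 : ∀ y ∈ V, (fun _ : E4 => s) y ≠ 0 := fun _ _ => hs
  have hG' : IsMetricOn (fun y : E4 => s • G y) V := isMetricOn_conformal hG hc hc0
  refine ⟨hG', fun x hx => ?_⟩
  have hθ : confForm (fun _ : E4 => s) x = 0 := by
    ext v
    exact confForm_const_apply x v
  have hchr : chrAt (fun y : E4 => s • G y) x = chrAt G x := by
    refine ContinuousLinearMap.ext fun X => ContinuousLinearMap.ext fun Y => ?_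
    calc chrAt (fun y : E4 => s • G y) x X Y
        = chrAt G x X Y + confDiff G (fun _ : E4 => s) x X Y :=
          hG.chrAt_conformal_eq hc hc0 hx X Y
      _ = chrAt G x X Y := by
          simp [confDiff, confVec, hθ]
  refine ⟨hchr, fun f => ?_⟩
  simp only [hessAt, hchr]

/-! ### Assembly -/

/-- (N-3ab) **Affine and constant-rescaling covariance** of the coordinate Killing expression,
of the coordinate Hessian, and of metric data: (1) the coordinate Killing expression of the
transformed pair `(G(c + L ·) ∘ (L × L), L⁻¹ k(c + L ·))` at `(y, Y, Z)` is that of `(G, k)` at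
`(c + L y, L Y, L Z)`; (2) `Hess_{G'} (f ∘ aff) y (Y, Z) = Hess_G f (aff y) (L Y, L Z)`
(O'Neill 1983, Ch. 3, Prop. 3.59: the Levi-Civita connection is natural); (3) `s • G`, `s ≠ 0`
constant, is a metric datum with the same Christoffel map and Hessian (Besse 1987,
Thm. 1.159 (a) with constant factor). [cite: ONeill1983, Ch. 3, Prop. 3.59] -/
theorem stub_affineCovariance :
    (∀ (G : E4 → E4 →L[ℝ] E4 →L[ℝ] ℝ) (k : E4 → E4) (L : E4 ≃L[ℝ] E4) (c y Y Z : E4),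
      DifferentiableAt ℝ G (c + L y) → DifferentiableAt ℝ k (c + L y) →
      fderiv ℝ (fun y : E4 => (G (c + L y)).bilinearComp (L : E4 →L[ℝ] E4) (L : E4 →L[ℝ] E4)) y
          ((L.symm : E4 →L[ℝ] E4) (k (c + L y))) Y Z
        + (G (c + L y)).bilinearComp (L : E4 →L[ℝ] E4) (L : E4 →L[ℝ] E4)
            (fderiv ℝ (fun y : E4 => (L.symm : E4 →L[ℝ] E4) (k (c + L y))) y Y) Z
        + (G (c + L y)).bilinearComp (L : E4 →L[ℝ] E4) (L : E4 →L[ℝ] E4) Y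
            (fderiv ℝ (fun y : E4 => (L.symm : E4 →L[ℝ] E4) (k (c + L y))) y Z)
        = fderiv ℝ G (c + L y) (k (c + L y)) (L Y) (L Z)
          + G (c + L y) (fderiv ℝ k (c + L y) (L Y)) (L Z)
          + G (c + L y) (L Y) (fderiv ℝ k (c + L y) (L Z))) ∧
    (∀ (G : E4 → E4 →L[ℝ] E4 →L[ℝ] ℝ) (f : E4 → ℝ) (L : E4 ≃L[ℝ] E4) (c y : E4) (V : Set E4),
      IsMetricOn G V → c + L y ∈ V → ContDiffAt ℝ 2 f (c + L y) → ∀ Y Z : E4,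
      hessAt (fun y : E4 => (G (c + L y)).bilinearComp (L : E4 →L[ℝ] E4) (L : E4 →L[ℝ] E4))
          (fun y : E4 => f (c + L y)) y Y Z
        = hessAt G f (c + L y) (L Y) (L Z)) ∧
    (∀ (G : E4 → E4 →L[ℝ] E4 →L[ℝ] ℝ) (V : Set E4) (s : ℝ), s ≠ 0 → IsMetricOn G V →
      IsMetricOn (fun y : E4 => s • G y) V ∧
      ∀ x ∈ V, chrAt (fun y : E4 => s • G y) x = chrAt G x ∧
        ∀ f : E4 → ℝ, hessAt (fun y : E4 => s • G y) f x = hessAt G f x) :=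
  ⟨fun G k L c y Y Z hG hk => affineCov_killingExpr G k L c y Y Z hG hk,
    fun G f L c y V hG hy hf Y Z => affineCov_hessAt G f L c y V hG hy hf Y Z,
    fun G V s hs hG => affineCov_constSmul G V s hs hG⟩

end Summit.FinalStateConjecture.FinalStateConjecture.Theorems

end
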